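import Summits.AtomisticToContinuum.Crystallization.Theorems.GappedShellCensusCleanLimitsHaveWindowsInplaneGain6
import Summits.AtomisticToContinuum.Crystallization.Theorems.GappedShellCensusCleanLimitsHaveWindowsInplaneGain7
import Summits.AtomisticToContinuum.Crystallization.Theorems.GappedShellCensusCleanLimitsHaveWindowsInplaneGain9

/-!
# `CleanLimitsHaveWindows` (stmt-AtomisticToContinuum-15932), line `Sketch`, stub `stub_inplaneGain`, helper 11:
# summation over the layers

Support file for the certified in-plane gain: the bookkeeping that turns per-layer lower bounds into a lower bound
for the sum over all layers `m' ≠ m`.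

* `ig_offset_tsum_lower`: if `b : ℤ → ℝ` is summable, `b 0 = 0`, `b (±1) ≥ g`, `b n ≥ -ℓ |n|` for `2 ≤ |n| ≤ 7`
  and `b n ≥ -C/|n|⁴` for `|n| ≥ 8`, then `∑' b ≥ 2g - 2(ℓ 2 + ⋯ + ℓ 7) - 2C/(3·7³)` (symmetrisation
  `tsum_nat_add_neg`, the tail `∑_{k ≥ 8} k⁻⁴ ≤ 1/(3·7³)` by `cvx_sum_inv_pow_le`); `ig_layers_tsum_lower` is the
  version centred at a layer `m`;
* `ig_summable_layers'`: summability over the layers of a family bounded by `C/(z m' - z m)⁴` beyond the adjacent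
  layers, for increments `≥ d₁ > 0`;
* `ig_sq_height_eq`: `(z m' - z m)² = (z (n + k) - z n)²` with `n = min m m'`, `k = |m' - m|`;
* `ig_generic_decay`: the algebra `k² (9 (k²T)⁻⁴ + (64/21)(1/3 + k²T)⁻³) ≤ (9T⁻⁴/64 + (64/21)T⁻³) k⁻⁴` for
  `k ≥ 8`, and its cubic analogue, for the generic far-layer bounds;
* the layer lemmas of helpers 4, 5 restated with the certified sums of helpers 6–10 and the certificate tables
  `ig_table_U1`, `ig_table_U2`, `ig_table_L1` (`igEllU1`, `igEllU2`, `igEllL1`).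
-/

noncomputable section

namespace Summit.AtomisticToContinuum.Crystallization.Theorems.CleanHull

open Summit.AtomisticToContinuum.Crystallization.Theorems.LayeredHull
open Literature.MathematicalPhysics.StatisticalMechanics Finset

/-! ## Lower bounds for sums over `ℤ` -/

/-- The quartic tail: `∑'_{i ≥ 0} ((i + 8)⁻¹)⁴ ≤ 1/(3 · 7³)`, and the family is summable. [folklore] -/
theorem ig_quartic_tail :
    (Summable fun i : ℕ => (((i : ℝ) + 8)⁻¹) ^ 4) ∧ ∑' i : ℕ, (((i : ℝ) + 8)⁻¹) ^ 4 ≤ 1 / (3 * 7 ^ 3) := by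
  have h0 : ∀ i : ℕ, 0 ≤ (((i : ℝ) + 8)⁻¹) ^ 4 := fun i => by positivity
  have hle : ∀ u : Finset ℕ, ∑ i ∈ u, (((i : ℝ) + 8)⁻¹) ^ 4 ≤ 1 / (3 * 7 ^ 3) := by
    intro u
    -- `u ⊆ range M`
    obtain ⟨M, hM⟩ : ∃ M : ℕ, u ⊆ range M := ⟨u.sup id + 1, fun i hi => mem_range.2 (Nat.lt_succ_of_le (le_sup (f := id) hi))⟩
    have h1 : ∑ i ∈ u, (((i : ℝ) + 8)⁻¹) ^ 4 ≤ ∑ i ∈ range M, (((i : ℝ) + 8)⁻¹) ^ 4 :=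
      sum_le_sum_of_subset_of_nonneg hM fun i _ _ => h0 i
    have h2 : ∑ i ∈ range M, (((i : ℝ) + 8)⁻¹) ^ 4 = ∑ k ∈ Ico 8 (M + 8), ((k : ℝ)⁻¹) ^ 4 := by
      rw [sum_Ico_eq_sum_range]
      simp only [Nat.add_sub_cancel]
      refine sum_congr rfl fun i _ => ?_
      push_cast; ring
    have h3 : ∑ k ∈ Ico 8 (M + 8), ((k : ℝ)⁻¹) ^ 4 ≤ (3 : ℝ)⁻¹ * ((7 : ℝ)⁻¹) ^ 3 := by
      rcases Nat.eq_zero_or_pos M with hM0 | hM0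
      · subst hM0; simp
      · have e : Ico 8 (M + 8) = Icc (7 + 1) (M + 7) := by
          ext k; simp only [mem_Ico, mem_Icc]; omega
        rw [e]
        have := cvx_sum_inv_pow_le 7 3 (by norm_num) (by norm_num) (M + 7)
        push_cast at this
        exact this
    calc ∑ i ∈ u, (((i : ℝ) + 8)⁻¹) ^ 4 ≤ ∑ k ∈ Ico 8 (M + 8), ((k : ℝ)⁻¹) ^ 4 := by rw [← h2]; exact h1
      _ ≤ (3 : ℝ)⁻¹ * ((7 : ℝ)⁻¹) ^ 3 := h3
      _ = 1 / (3 * 7 ^ 3) := by norm_num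
  exact ⟨summable_of_sum_le h0 hle, Real.tsum_le_of_sum_le h0 hle⟩

/-- **Lower bound for a symmetric-type sum over `ℤ`.** [folklore] -/
theorem ig_offset_tsum_lower (b : ℤ → ℝ) (hb : Summable b) (g C : ℝ) (ℓ : ℕ → ℝ) (h0 : b 0 = 0)
    (h1 : g ≤ b 1) (h1' : g ≤ b (-1))
    (hmid : ∀ n : ℤ, 2 ≤ n.natAbs → n.natAbs ≤ 7 → -ℓ n.natAbs ≤ b n)
    (hfar : ∀ n : ℤ, 8 ≤ n.natAbs → -(C / (n.natAbs : ℝ) ^ 4) ≤ b n) (hC : 0 ≤ C) :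
    2 * g - 2 * (ℓ 2 + ℓ 3 + ℓ 4 + ℓ 5 + ℓ 6 + ℓ 7) - 2 * C / (3 * 7 ^ 3) ≤ ∑' n, b n := by
  have hsym := tsum_nat_add_neg hb
  rw [h0, add_zero] at hsym
  rw [← hsym]
  set c : ℕ → ℝ := fun n => b n + b (-n) with hc
  have hcs : Summable c := hb.nat_add_neg
  -- termwise lower bounds for `c`
  have hcmid : ∀ n : ℕ, 2 ≤ n → n ≤ 7 → -(2 * ℓ n) ≤ c n := by
    intro n h2 h7
    have e1 : ((n : ℤ)).natAbs = n := Int.natAbs_natCast n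
    have e2 : (-(n : ℤ)).natAbs = n := by rw [Int.natAbs_neg, Int.natAbs_natCast]
    have ha := hmid n (by rw [e1]; exact h2) (by rw [e1]; exact h7)
    have hb' := hmid (-(n : ℤ)) (by rw [e2]; exact h2) (by rw [e2]; exact h7)
    rw [e1] at ha; rw [e2] at hb'
    show -(2 * ℓ n) ≤ b n + b (-n)
    linarith
  have hcfar : ∀ n : ℕ, 8 ≤ n → -(2 * C / (n : ℝ) ^ 4) ≤ c n := by
    intro n h8
    have e1 : ((n : ℤ)).natAbs = n := Int.natAbs_natCast n
    have e2 : (-(n : ℤ)).natAbs = n := by rw [Int.natAbs_neg, Int.natAbs_natCast]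
    have ha := hfar n (by rw [e1]; exact h8)
    have hb' := hfar (-(n : ℤ)) (by rw [e2]; exact h8)
    rw [e1] at ha; rw [e2] at hb'
    show -(2 * C / (n : ℝ) ^ 4) ≤ b n + b (-n)
    have : 2 * C / (n : ℝ) ^ 4 = C / (n : ℝ) ^ 4 + C / (n : ℝ) ^ 4 := by ring
    linarith
  have hc0 : c 0 = 0 := by show b 0 + b (-0) = 0; simp [h0]
  have hc1 : 2 * g ≤ c 1 := by show 2 * g ≤ b 1 + b (-1); linarith
  -- split off the first eight terms
  rw [← hcs.sum_add_tsum_nat_add 8]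
  have hhead : 2 * g - 2 * (ℓ 2 + ℓ 3 + ℓ 4 + ℓ 5 + ℓ 6 + ℓ 7) ≤ ∑ i ∈ range 8, c i := by
    simp only [sum_range_succ, sum_range_zero, zero_add, hc0]
    have h2 := hcmid 2 (by norm_num) (by norm_num)
    have h3 := hcmid 3 (by norm_num) (by norm_num)
    have h4 := hcmid 4 (by norm_num) (by norm_num)
    have h5 := hcmid 5 (by norm_num) (by norm_num)
    have h6 := hcmid 6 (by norm_num) (by norm_num)
    have h7 := hcmid 7 (by norm_num) (by norm_num)
    linarith
  -- the tail
  obtain ⟨hqs, hqle⟩ := ig_quartic_tail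
  have htail : -(2 * C / (3 * 7 ^ 3)) ≤ ∑' i : ℕ, c (i + 8) := by
    have hterm : ∀ i : ℕ, -(2 * C * (((i : ℝ) + 8)⁻¹) ^ 4) ≤ c (i + 8) := by
      intro i
      have := hcfar (i + 8) (by omega)
      have e : 2 * C / ((i + 8 : ℕ) : ℝ) ^ 4 = 2 * C * (((i : ℝ) + 8)⁻¹) ^ 4 := by
        push_cast; rw [div_eq_mul_inv, inv_pow]
      rwa [e] at this
    have hs8 : Summable fun i : ℕ => c (i + 8) := (summable_nat_add_iff 8).2 hcs
    have h3 := Summable.tsum_le_tsum hterm (hqs.mul_left (2 * C)).neg hs8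
    rw [tsum_neg, tsum_mul_left] at h3
    have h4 : 2 * C * ∑' i : ℕ, (((i : ℝ) + 8)⁻¹) ^ 4 ≤ 2 * C / (3 * 7 ^ 3) := by
      have := mul_le_mul_of_nonneg_left hqle (by positivity : 0 ≤ 2 * C)
      rw [mul_one_div] at this
      exact this
    linarith
  linarith

/-- **Lower bound for the sum over the layers `m' ≠ m`** from per-layer lower bounds indexed by the layer
distance `k = |m' - m|`. [folklore] -/
theorem ig_layers_tsum_lower (d : ℤ → ℝ) (m : ℤ) (hd : Summable d) (g C : ℝ) (ℓ : ℕ → ℝ) (h0 : d m = 0)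
    (h1 : g ≤ d (m + 1)) (h1' : g ≤ d (m - 1))
    (hmid : ∀ m' : ℤ, 2 ≤ (m' - m).natAbs → (m' - m).natAbs ≤ 7 → -ℓ (m' - m).natAbs ≤ d m')
    (hfar : ∀ m' : ℤ, 8 ≤ (m' - m).natAbs → -(C / ((m' - m).natAbs : ℝ) ^ 4) ≤ d m') (hC : 0 ≤ C) :
    2 * g - 2 * (ℓ 2 + ℓ 3 + ℓ 4 + ℓ 5 + ℓ 6 + ℓ 7) - 2 * C / (3 * 7 ^ 3) ≤ ∑' m', d m' := by
  have e := (Equiv.addRight m).tsum_eq d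
  rw [← e]
  have hb : Summable fun n : ℤ => d (Equiv.addRight m n) := (Equiv.summable_iff (Equiv.addRight m)).2 hd
  refine ig_offset_tsum_lower (fun n => d (Equiv.addRight m n)) hb g C ℓ ?_ ?_ ?_ ?_ ?_ hC
  · simp [h0]
  · simpa [add_comm] using h1
  · simpa [sub_eq_add_neg, add_comm] using h1'
  · intro n h2 h7
    have := hmid (n + m) (by simpa using h2) (by simpa using h7)
    simpa using this
  · intro n h8
    have := hfar (n + m) (by simpa using h8)
    simpa using this

/-! ## Summability over the layers -/

/-- One-sided height bound: increments `≥ d₁` give `z(n+k) - z(n) ≥ k d₁`. [folklore] -/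
theorem ig_height_lower (z : ℤ → ℝ) {d₁ : ℝ} (hz : ∀ m, d₁ ≤ z (m + 1) - z m) (n : ℤ) (k : ℕ) :
    (k : ℝ) * d₁ ≤ z (n + k) - z n := by
  induction k with
  | zero => simp
  | succ k ih =>
    have := hz (n + k)
    push_cast
    rw [show n + ((k : ℤ) + 1) = n + k + 1 by ring]
    linarith

/-- Heights are at least `d₁ |m' - m|` in absolute value when all increments are `≥ d₁ ≥ 0`. [folklore] -/
theorem ig_abs_height_ge (z : ℤ → ℝ) {d₁ : ℝ} (hd₁ : 0 ≤ d₁) (hz : ∀ m, d₁ ≤ z (m + 1) - z m) (m m' : ℤ) :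
    d₁ * ((m' - m).natAbs : ℝ) ≤ |z m' - z m| := by
  have hk0 : (0 : ℝ) ≤ ((m' - m).natAbs : ℝ) := Nat.cast_nonneg _
  rcases le_or_gt m m' with h | h
  · have := ig_height_lower z hz m (m' - m).natAbs
    rw [show m + ((m' - m).natAbs : ℤ) = m' by omega] at this
    rw [abs_of_nonneg (by nlinarith)]
    linarith
  · have := ig_height_lower z hz m' (m' - m).natAbs
    rw [show m' + ((m' - m).natAbs : ℤ) = m by omega] at this
    rw [abs_sub_comm, abs_of_nonneg (by nlinarith)]
    linarith

/-- **Summability over the layers** of a family bounded by `C/(z m' - z m)⁴` beyond the adjacent layers, for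
increments `≥ d₁ > 0` (comparison with `C d₁⁻⁴ (m' - m)⁻⁴` plus a finitely supported part). [folklore] -/
theorem ig_summable_layers' (z : ℤ → ℝ) {d₁ : ℝ} (hd₁ : 0 < d₁) (hz : ∀ m, d₁ ≤ z (m + 1) - z m) (m : ℤ)
    (f : ℤ → ℝ) {C : ℝ} (hC : 0 ≤ C) (hf : ∀ m', 2 ≤ (m' - m).natAbs → |f m'| ≤ C / (z m' - z m) ^ 4) :
    Summable f := by
  have h4 : Summable fun n : ℤ => 1 / (n : ℝ) ^ 4 := Real.summable_one_div_int_pow.2 (by norm_num)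
  have h5 : Summable fun m' : ℤ => 1 / (((m' - m : ℤ) : ℝ)) ^ 4 := by
    have h5' := h4.comp_injective (sub_left_injective (b := m))
    exact h5'.congr fun m' => by simp only [Function.comp_apply]
  set S : Finset ℤ := {m - 1, m, m + 1} with hS
  have hfin : Summable fun m' : ℤ => if m' ∈ S then |f m'| else (0 : ℝ) :=
    summable_of_ne_finset_zero (s := S) fun m' hm' => if_neg hm'
  refine Summable.of_norm_bounded ((h5.mul_left (C / d₁ ^ 4)).add hfin) fun m' => ?_
  rw [Real.norm_eq_abs]
  by_cases hm : m' ∈ S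
  · rw [if_pos hm]
    have : 0 ≤ C / d₁ ^ 4 * (1 / (((m' - m : ℤ) : ℝ)) ^ 4) := by positivity
    linarith
  · rw [if_neg hm, add_zero]
    have hk : 2 ≤ (m' - m).natAbs := by
      rw [hS] at hm
      simp only [Finset.mem_insert, Finset.mem_singleton] at hm
      omega
    refine (hf m' hk).trans ?_
    have hge := ig_abs_height_ge z hd₁.le hz m m'
    have hkpos : (0 : ℝ) < ((m' - m).natAbs : ℝ) := by exact_mod_cast (show 0 < (m' - m).natAbs by omega)
    have hpos : 0 < d₁ * ((m' - m).natAbs : ℝ) := mul_pos hd₁ hkpos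
    have h3 : (d₁ * ((m' - m).natAbs : ℝ)) ^ 4 ≤ (z m' - z m) ^ 4 := by
      rw [← abs_of_nonneg (by positivity : (0 : ℝ) ≤ (z m' - z m) ^ 4), ← pow_abs]
      exact pow_le_pow_left₀ hpos.le hge 4
    have hcast : (((m' - m : ℤ) : ℝ)) ^ 4 = (((m' - m).natAbs : ℝ)) ^ 4 := by
      rw [Nat.cast_natAbs, Int.cast_abs]
      push_cast
      rw [pow_abs, abs_of_nonneg (by positivity)]
    calc C / (z m' - z m) ^ 4 ≤ C / (d₁ * ((m' - m).natAbs : ℝ)) ^ 4 :=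
          div_le_div_of_nonneg_left hC (pow_pos hpos 4) h3
      _ = C / d₁ ^ 4 * (1 / (((m' - m : ℤ) : ℝ)) ^ 4) := by rw [hcast, mul_pow]; field_simp

/-! ## Heights seen from either side -/

/-- `(z m' - z m)² = (z (n + k) - z n)²` with `n = min m m'`, `k = |m' - m|`. [folklore] -/
theorem ig_sq_height_eq (z : ℤ → ℝ) (m m' : ℤ) :
    (z m' - z m) ^ 2 = (z (min m m' + ((m' - m).natAbs : ℕ)) - z (min m m')) ^ 2 := by
  rcases le_or_gt m m' with h | h
  · rw [min_eq_left h, show m + (((m' - m).natAbs : ℕ) : ℤ) = m' by omega]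
  · rw [min_eq_right h.le, show m' + (((m' - m).natAbs : ℕ) : ℤ) = m by omega]
    ring

/-! ## The generic far-layer decay in the layer distance -/

/-- For `k ≥ 8`, `T > 0`, `c ≥ 0`:
`c k² (9 ((k² T)⁻¹)⁴ + (64/21)((1/3 + k² T)⁻¹)³) ≤ c (9 T⁻⁴/64 + (64/21) T⁻³) k⁻⁴`. [folklore] -/
theorem ig_generic_decay4 {c T k : ℝ} (hc : 0 ≤ c) (hT : 0 < T) (hk : 8 ≤ k) :
    c * k ^ 2 * (9 * ((k ^ 2 * T)⁻¹) ^ 4 + 64 / 21 * ((1 / 3 + k ^ 2 * T)⁻¹) ^ 3) ≤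
      c * (9 * (T⁻¹) ^ 4 / 64 + 64 / 21 * (T⁻¹) ^ 3) * (k⁻¹) ^ 4 := by
  have hk0 : 0 < k := by linarith
  set u := k⁻¹ with hu
  have hu0 : 0 < u := inv_pos.2 hk0
  have hu8 : u ≤ 1 / 8 := by rw [hu, one_div]; exact inv_anti₀ (by norm_num) hk
  have hku : k = u⁻¹ := by rw [hu, inv_inv]
  have h1 : ((k ^ 2 * T)⁻¹) ^ 4 = u ^ 8 * (T⁻¹) ^ 4 := by rw [hku, mul_inv, inv_pow, inv_inv]; ring
  have h2 : ((1 / 3 + k ^ 2 * T)⁻¹) ^ 3 ≤ u ^ 6 * (T⁻¹) ^ 3 := by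
    have : (1 / 3 + k ^ 2 * T)⁻¹ ≤ (k ^ 2 * T)⁻¹ := inv_anti₀ (by positivity) (by linarith)
    calc ((1 / 3 + k ^ 2 * T)⁻¹) ^ 3 ≤ ((k ^ 2 * T)⁻¹) ^ 3 := pow_le_pow_left₀ (by positivity) this 3
      _ = u ^ 6 * (T⁻¹) ^ 3 := by rw [hku, mul_inv, inv_pow, inv_inv]; ring
  have hk2 : k ^ 2 = (u⁻¹) ^ 2 := by rw [hku]
  have hT4 : 0 ≤ (T⁻¹) ^ 4 := by positivity
  have hT3 : 0 ≤ (T⁻¹) ^ 3 := by positivity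
  have hu2 : u ^ 2 ≤ 1 / 64 := by nlinarith
  calc c * k ^ 2 * (9 * ((k ^ 2 * T)⁻¹) ^ 4 + 64 / 21 * ((1 / 3 + k ^ 2 * T)⁻¹) ^ 3)
      ≤ c * k ^ 2 * (9 * (u ^ 8 * (T⁻¹) ^ 4) + 64 / 21 * (u ^ 6 * (T⁻¹) ^ 3)) := by
        rw [h1]
        apply mul_le_mul_of_nonneg_left _ (by positivity)
        linarith
    _ = c * (9 * (T⁻¹) ^ 4 * u ^ 2 + 64 / 21 * (T⁻¹) ^ 3) * u ^ 4 := by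
        rw [hk2]; field_simp
    _ ≤ c * (9 * (T⁻¹) ^ 4 / 64 + 64 / 21 * (T⁻¹) ^ 3) * u ^ 4 := by
        apply mul_le_mul_of_nonneg_right _ (by positivity)
        apply mul_le_mul_of_nonneg_left _ hc
        nlinarith [mul_le_mul_of_nonneg_left hu2 (show 0 ≤ 9 * (T⁻¹) ^ 4 by positivity)]

/-- For `k ≥ 8`, `T > 0`, `c ≥ 0`: `c (9 ((k² T)⁻¹)³ + (32/7)((1/3 + k² T)⁻¹)²) ≤ c (9 T⁻³/64 + (32/7) T⁻²) k⁻⁴`.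
[folklore] -/
theorem ig_generic_decay3 {c T k : ℝ} (hc : 0 ≤ c) (hT : 0 < T) (hk : 8 ≤ k) :
    c * (9 * ((k ^ 2 * T)⁻¹) ^ 3 + 32 / 7 * ((1 / 3 + k ^ 2 * T)⁻¹) ^ 2) ≤
      c * (9 * (T⁻¹) ^ 3 / 64 + 32 / 7 * (T⁻¹) ^ 2) * (k⁻¹) ^ 4 := by
  have hk0 : 0 < k := by linarith
  set u := k⁻¹ with hu
  have hu0 : 0 < u := inv_pos.2 hk0
  have hu8 : u ≤ 1 / 8 := by rw [hu, one_div]; exact inv_anti₀ (by norm_num) hk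
  have hku : k = u⁻¹ := by rw [hu, inv_inv]
  have h1 : ((k ^ 2 * T)⁻¹) ^ 3 = u ^ 6 * (T⁻¹) ^ 3 := by rw [hku, mul_inv, inv_pow, inv_inv]; ring
  have h2 : ((1 / 3 + k ^ 2 * T)⁻¹) ^ 2 ≤ u ^ 4 * (T⁻¹) ^ 2 := by
    have : (1 / 3 + k ^ 2 * T)⁻¹ ≤ (k ^ 2 * T)⁻¹ := inv_anti₀ (by positivity) (by linarith)
    calc ((1 / 3 + k ^ 2 * T)⁻¹) ^ 2 ≤ ((k ^ 2 * T)⁻¹) ^ 2 := pow_le_pow_left₀ (by positivity) this 2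
      _ = u ^ 4 * (T⁻¹) ^ 2 := by rw [hku, mul_inv, inv_pow, inv_inv]; ring
  have hT3 : 0 ≤ (T⁻¹) ^ 3 := by positivity
  have hT2 : 0 ≤ (T⁻¹) ^ 2 := by positivity
  have hu2 : u ^ 2 ≤ 1 / 64 := by nlinarith
  calc c * (9 * ((k ^ 2 * T)⁻¹) ^ 3 + 32 / 7 * ((1 / 3 + k ^ 2 * T)⁻¹) ^ 2)
      ≤ c * (9 * (u ^ 6 * (T⁻¹) ^ 3) + 32 / 7 * (u ^ 4 * (T⁻¹) ^ 2)) := by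
        rw [h1]
        apply mul_le_mul_of_nonneg_left _ hc
        linarith
    _ = c * (9 * (T⁻¹) ^ 3 * u ^ 2 + 32 / 7 * (T⁻¹) ^ 2) * u ^ 4 := by ring
    _ ≤ c * (9 * (T⁻¹) ^ 3 / 64 + 32 / 7 * (T⁻¹) ^ 2) * u ^ 4 := by
        apply mul_le_mul_of_nonneg_right _ (by positivity)
        apply mul_le_mul_of_nonneg_left _ hc
        nlinarith [mul_le_mul_of_nonneg_left hu2 (show 0 ≤ 9 * (T⁻¹) ^ 3 by positivity)]

/-! ## The certificate tables -/

/-- **Certificate table**, U1: for `2 ≤ k ≤ 7` and both cosets. [folklore] -/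
theorem ig_table_U1 (k : ℕ) (hk2 : 2 ≤ k) (hk7 : k ≤ 7) (δ : ℤ) (hδ : δ = 0 ∨ δ = 1) :
    -igEllU1 k ≤ igFarSumU (9801 / 10000) (1) (143 / 300) (7137 / 10000) (672963 / 200000000) 5 k δ := by
  interval_cases k
  · rcases hδ with rfl | rfl
    · have h := ig_cert_farU1_2_0; norm_num [igEllU1] at h ⊢; linarith
    · have h := ig_cert_farU1_2_1; norm_num [igEllU1] at h ⊢; linarith
  · rcases hδ with rfl | rfl
    · have h := ig_cert_farU1_3_0; norm_num [igEllU1] at h ⊢; linarith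
    · have h := ig_cert_farU1_3_1; norm_num [igEllU1] at h ⊢; linarith
  · rcases hδ with rfl | rfl
    · have h := ig_cert_farU1_4_0; norm_num [igEllU1] at h ⊢; linarith
    · have h := ig_cert_farU1_4_1; norm_num [igEllU1] at h ⊢; linarith
  · rcases hδ with rfl | rfl
    · have h := ig_cert_farU1_5_0; norm_num [igEllU1] at h ⊢; linarith
    · have h := ig_cert_farU1_5_1; norm_num [igEllU1] at h ⊢; linarith
  · rcases hδ with rfl | rfl
    · have h := ig_cert_farU1_6_0; norm_num [igEllU1] at h ⊢; linarith
    · have h := ig_cert_farU1_6_1; norm_num [igEllU1] at h ⊢; linarith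
  · rcases hδ with rfl | rfl
    · have h := ig_cert_farU1_7_0; norm_num [igEllU1] at h ⊢; linarith
    · have h := ig_cert_farU1_7_1; norm_num [igEllU1] at h ⊢; linarith

/-- **Certificate table**, U2: for `2 ≤ k ≤ 7` and both cosets. [folklore] -/
theorem ig_table_U2 (k : ℕ) (hk2 : 2 ≤ k) (hk7 : k ≤ 7) (δ : ℤ) (hδ : δ = 0 ∨ δ = 1) :
    -igEllU2 k ≤ igFarSumU (1) (2601 / 2500) (579 / 1250) (5303 / 7500) (140187 / 40000000) 5 k δ := by
  interval_cases k
  · rcases hδ with rfl | rfl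
    · have h := ig_cert_farU2_2_0; norm_num [igEllU2] at h ⊢; linarith
    · have h := ig_cert_farU2_2_1; norm_num [igEllU2] at h ⊢; linarith
  · rcases hδ with rfl | rfl
    · have h := ig_cert_farU2_3_0; norm_num [igEllU2] at h ⊢; linarith
    · have h := ig_cert_farU2_3_1; norm_num [igEllU2] at h ⊢; linarith
  · rcases hδ with rfl | rfl
    · have h := ig_cert_farU2_4_0; norm_num [igEllU2] at h ⊢; linarith
    · have h := ig_cert_farU2_4_1; norm_num [igEllU2] at h ⊢; linarith
  · rcases hδ with rfl | rfl
    · have h := ig_cert_farU2_5_0; norm_num [igEllU2] at h ⊢; linarith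
    · have h := ig_cert_farU2_5_1; norm_num [igEllU2] at h ⊢; linarith
  · rcases hδ with rfl | rfl
    · have h := ig_cert_farU2_6_0; norm_num [igEllU2] at h ⊢; linarith
    · have h := ig_cert_farU2_6_1; norm_num [igEllU2] at h ⊢; linarith
  · rcases hδ with rfl | rfl
    · have h := ig_cert_farU2_7_0; norm_num [igEllU2] at h ⊢; linarith
    · have h := ig_cert_farU2_7_1; norm_num [igEllU2] at h ⊢; linarith

/-- **Certificate table**, L1: for `2 ≤ k ≤ 7` and both cosets. [folklore] -/
theorem ig_table_L1 (k : ℕ) (hk2 : 2 ≤ k) (hk7 : k ≤ 7) (δ : ℤ) (hδ : δ = 0 ∨ δ = 1) :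
    -igEllL1 k ≤ igFarSumL (529 / 625) (36481 / 40000) (60719 / 120000) (5687 / 7500) (502943 / 1000000) (2303179 / 1000000000) 6 k δ := by
  interval_cases k
  · rcases hδ with rfl | rfl
    · have h := ig_cert_farL1_2_0; norm_num [igEllL1] at h ⊢; linarith
    · have h := ig_cert_farL1_2_1; norm_num [igEllL1] at h ⊢; linarith
  · rcases hδ with rfl | rfl
    · have h := ig_cert_farL1_3_0; norm_num [igEllL1] at h ⊢; linarith
    · have h := ig_cert_farL1_3_1; norm_num [igEllL1] at h ⊢; linarith
  · rcases hδ with rfl | rfl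
    · have h := ig_cert_farL1_4_0; norm_num [igEllL1] at h ⊢; linarith
    · have h := ig_cert_farL1_4_1; norm_num [igEllL1] at h ⊢; linarith
  · rcases hδ with rfl | rfl
    · have h := ig_cert_farL1_5_0; norm_num [igEllL1] at h ⊢; linarith
    · have h := ig_cert_farL1_5_1; norm_num [igEllL1] at h ⊢; linarith
  · rcases hδ with rfl | rfl
    · have h := ig_cert_farL1_6_0; norm_num [igEllL1] at h ⊢; linarith
    · have h := ig_cert_farL1_6_1; norm_num [igEllL1] at h ⊢; linarith
  · rcases hδ with rfl | rfl
    · have h := ig_cert_farL1_7_0; norm_num [igEllL1] at h ⊢; linarith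
    · have h := ig_cert_farL1_7_1; norm_num [igEllL1] at h ⊢; linarith

/-- The table values are nonnegative. [folklore] -/
theorem ig_ell_nonneg (k : ℕ) : 0 ≤ igEllU1 k ∧ 0 ≤ igEllU2 k ∧ 0 ≤ igEllL1 k := by
  unfold igEllU1 igEllU2 igEllL1
  refine ⟨?_, ?_, ?_⟩ <;> split_ifs <;> norm_num

end Summit.AtomisticToContinuum.Crystallization.Theorems.CleanHull

end
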